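import Summits.BirchSwinnertonDyer.Rank1Residual.GaloisImage.KolyvaginPrimeLocalShapeRat
import Literature.NumberTheory.GaloisRepresentations.ModPCyclotomicCharacterInertiaSurjective
import HarnessLib

/-!
# Kolyvagin-prime LOCAL SHAPE over `ℚ`: the cited local input DISCHARGED, and the unconditional
# `K = ℚ` readings of (T)/(UT) (row T-R1-16-LOC, p18; consumer p11 = R1-16)

HONEST FRAMING (cell `b2b-bsdres`, run/shared/lean/b2b/bsd-rank1-residual/, verbatim in every
file): the goal of the cell is to DELETE the COMBINATION-SHAPED residual classes of the
Birch–Swinnerton-Dyer formula for ALL analytic-rank `≤ 1` elliptic curves over `ℚ` — "full BSD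
formula for every rank `≤ 1` curve in class `C`" assembled STRICTLY from published theorems — so
that the rank-`≤ 1` remainder becomes exactly the CONSTRUCTION-SHAPED classes, which are TYPED
(missing-input `Prop`s), NOT attempted. This is not "finishing BSD". Team n1011 (N10/N11, the
additive block `X4 ∧ p = 3`): research route; TOOL theorems of local Galois cohomology, no class
theorem, nothing booked, no mark changed.

`KolyvaginPrimeLocalShapeRat.lean` carries the one local input of row T-R1-16-LOC as the named
fact `modPCyclotomicCharacter_surjOn_absInertia_rat : Prop` (Serre, *Local Fields* IV §4
Prop. 17–18 at `n = 1`, `K = ℚ`: `χ̄_ℓ` maps the inertia group of `ℚ_v` ONTO `(ℤ/ℓ)ˣ`,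
`ℓ = Nv`).  The literature seat has since PROVED that statement in the tree
(`Literature.NumberTheory.GaloisRepresentations.Rat.exists_mem_absInertia_adicCompletion_modPCyclotomicCharacterZMod_eq_of_absNorm_eq`,
from the level-one fundamental character), so here:

* `modPCyclotomicCharacter_surjOn_absInertia_rat_holds` — the named fact is a THEOREM;
* the `K = ℚ` readings of (T) and (UT) of `KolyvaginPrimeLocalShapeRat.lean` with the hypothesis
  `h17` DISCHARGED (primed names, same remaining binders): for a finite discrete `Γ_ℚ`-module `M`,
  a Kolyvagin datum with `D.primes = frobeniusClassPrimes ρ S τ N` and the cyclotomic transverse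
  condition, `#𝒯_𝔮 = N` and `H¹_ur ⊔ 𝒯_𝔮 = H¹(ℚ_𝔮, M)` at every prime of the datum — p11's binders
  (T)/(UT) of R1-16 for `E[3]` over `ℚ` need NO cited input any more ((U) never did).

References: J.-P. Serre, *Local Fields* (1979) Ch. IV §4 Prop. 17–18 [SerreLocalFields1979];
K. Rubin, *Euler systems and Kolyvagin systems* (PCMI 18, 2011) Prop. 1.9.5 [Rubin2011].
-/

noncomputable section

open scoped Classical

namespace Summit.BirchSwinnertonDyer.Rank1Residual.GaloisImage

open Field NumberField IsDedekindDomain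
open Literature.NumberTheory.GaloisRepresentations
open Literature.NumberTheory.GaloisCohomology
open scoped NumberField

/-- **The cited local input of row T-R1-16-LOC is a theorem**: for every finite place `v` of `ℚ`
with `ℓ = Nv` prime, `χ̄_ℓ` maps `absInertia (ℚ_v)` onto `(ℤ/ℓ)ˣ` (Serre LF IV §4 Prop. 17–18 at
`n = 1`), by the literature seat's
`Rat.exists_mem_absInertia_adicCompletion_modPCyclotomicCharacterZMod_eq_of_absNorm_eq`.
[cite: SerreLocalFields1979, Ch. IV §4, Prop. 17 and Prop. 18] -/
theorem modPCyclotomicCharacter_surjOn_absInertia_rat_holds :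
    modPCyclotomicCharacter_surjOn_absInertia_rat :=
  fun v _ _ u =>
    Rat.exists_mem_absInertia_adicCompletion_modPCyclotomicCharacterZMod_eq_of_absNorm_eq v rfl u

section RatReadingUnconditional

/-- **(T) over `ℚ`, unconditional**: for a finite discrete `Γ_ℚ`-module `M`,
`𝔮 ∈ frobeniusClassPrimes ρ S τ N` with `M/(τ − 1)M ≃ ℤ/N` and `(N𝔮 − 1)M = 0`: `#𝒯_𝔮 = N`.
[cite: Rubin2011, Prop. 1.9.5 (1) (p. 16)] -/
theorem natCard_cyclotomicTransverse_rat_of_mem_frobeniusClassPrimes'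
    {M : Type} [AddCommGroup M] [TopologicalSpace M] [DiscreteTopology M] [Finite M]
    (ρ : DiscreteGaloisModule ℚ M)
    {S : Set (HeightOneSpectrum (𝓞 ℚ))} {τ : absoluteGaloisGroup ℚ} {N : ℕ}
    {q : HeightOneSpectrum (𝓞 ℚ)} (hq : q ∈ frobeniusClassPrimes ρ S τ N)
    (hτ : Nonempty (cokerSubOne ρ τ ≃+ ZMod N))
    (hM : ∀ m : M, (Ideal.absNorm q.asIdeal - 1) • m = 0) :
    Nat.card (cyclotomicTransverse ρ (Sum.inr q)) = N :=
  natCard_cyclotomicTransverse_rat_of_mem_frobeniusClassPrimes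
    modPCyclotomicCharacter_surjOn_absInertia_rat_holds ρ hq hτ hM

/-- **p11's binder (T) of R1-16 over `ℚ`, unconditional** (modulo `(N𝔮 − 1)M = 0` at the primes
of the datum). [cite: Rubin2011, Prop. 1.9.5 (1) (p. 16)] -/
theorem natCard_transverse_rat_of_primes_eq'
    {M : Type} [AddCommGroup M] [TopologicalSpace M] [DiscreteTopology M] [Finite M]
    (ρ : DiscreteGaloisModule ℚ M) {D : KolyvaginDatum ρ}
    {S : Set (HeightOneSpectrum (𝓞 ℚ))} {τ : absoluteGaloisGroup ℚ} {N : ℕ}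
    (hP : D.primes = frobeniusClassPrimes ρ S τ N) (hT : D.transverse = cyclotomicTransverse ρ)
    (hτ : Nonempty (cokerSubOne ρ τ ≃+ ZMod N))
    (hM : ∀ q ∈ D.primes, ∀ m : M, (Ideal.absNorm q.asIdeal - 1) • m = 0) :
    ∀ q ∈ D.primes, Nat.card (D.transverse (Sum.inr q)) = N :=
  natCard_transverse_rat_of_primes_eq modPCyclotomicCharacter_surjOn_absInertia_rat_holds ρ hP hT
    hτ hM

/-- **(UT) over `ℚ`, unconditional** (modulo `(N𝔮 − 1)M = 0` at the primes of the datum).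
[cite: Rubin2011, Prop. 1.9.5 (3) (p. 16)] -/
theorem unramifiedSubgroup_sup_transverse_eq_top_rat_of_primes_eq'
    {M : Type} [AddCommGroup M] [TopologicalSpace M] [DiscreteTopology M] [Finite M]
    (ρ : DiscreteGaloisModule ℚ M) {D : KolyvaginDatum ρ}
    {S : Set (HeightOneSpectrum (𝓞 ℚ))} {τ : absoluteGaloisGroup ℚ} {N : ℕ}
    (hP : D.primes = frobeniusClassPrimes ρ S τ N) (hT : D.transverse = cyclotomicTransverse ρ)
    (hM : ∀ q ∈ D.primes, ∀ m : M, (Ideal.absNorm q.asIdeal - 1) • m = 0) :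
    ∀ q ∈ D.primes, DiscreteGaloisModule.unramifiedSubgroup (GaloisRep.toLocal q ρ) 1 ⊔
      D.transverse (Sum.inr q) = ⊤ :=
  unramifiedSubgroup_sup_transverse_eq_top_rat_of_primes_eq
    modPCyclotomicCharacter_surjOn_absInertia_rat_holds ρ hP hT hM

/-- **(T) over `ℚ` for a module killed by `N` and `τ ∈ Gal(ℚ̄/ℚ(μ_N))`, unconditional** (the
N11 / `E[N]` shape).  [cite: Rubin2011, Prop. 1.9.5 (1) (p. 16)] -/
theorem natCard_transverse_rat_of_primes_eq_of_smul_eq_zero'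
    {M : Type} [AddCommGroup M] [TopologicalSpace M] [DiscreteTopology M] [Finite M]
    (ρ : DiscreteGaloisModule ℚ M) {D : KolyvaginDatum ρ}
    {S : Set (HeightOneSpectrum (𝓞 ℚ))} {τ : absoluteGaloisGroup ℚ} {N : ℕ} [NeZero N]
    (hP : D.primes = frobeniusClassPrimes ρ S τ N) (hT : D.transverse = cyclotomicTransverse ρ)
    (hτ : Nonempty (cokerSubOne ρ τ ≃+ ZMod N)) (hτμ : τ ∈ rootsOfUnityFixer ℚ N)
    (hMN : ∀ m : M, N • m = 0) :
    ∀ q ∈ D.primes, Nat.card (D.transverse (Sum.inr q)) = N :=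
  natCard_transverse_rat_of_primes_eq_of_smul_eq_zero
    modPCyclotomicCharacter_surjOn_absInertia_rat_holds ρ hP hT hτ hτμ hMN

/-- **(UT) over `ℚ` for a module killed by `N` and `τ ∈ Gal(ℚ̄/ℚ(μ_N))`, unconditional.**
[cite: Rubin2011, Prop. 1.9.5 (3) (p. 16)] -/
theorem unramifiedSubgroup_sup_transverse_eq_top_rat_of_primes_eq_of_smul_eq_zero'
    {M : Type} [AddCommGroup M] [TopologicalSpace M] [DiscreteTopology M] [Finite M]
    (ρ : DiscreteGaloisModule ℚ M) {D : KolyvaginDatum ρ}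
    {S : Set (HeightOneSpectrum (𝓞 ℚ))} {τ : absoluteGaloisGroup ℚ} {N : ℕ} [NeZero N]
    (hP : D.primes = frobeniusClassPrimes ρ S τ N) (hT : D.transverse = cyclotomicTransverse ρ)
    (hτμ : τ ∈ rootsOfUnityFixer ℚ N) (hMN : ∀ m : M, N • m = 0) :
    ∀ q ∈ D.primes, DiscreteGaloisModule.unramifiedSubgroup (GaloisRep.toLocal q ρ) 1 ⊔
      D.transverse (Sum.inr q) = ⊤ :=
  unramifiedSubgroup_sup_transverse_eq_top_rat_of_primes_eq_of_smul_eq_zero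
    modPCyclotomicCharacter_surjOn_absInertia_rat_holds ρ hP hT hτμ hMN

end RatReadingUnconditional

end Summit.BirchSwinnertonDyer.Rank1Residual.GaloisImage

end
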